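/-
  Summits/AtomisticToContinuum/Crystallization/Theorems/OverbindingBudgetAffineFarFrameLattice.lean

  residual stmt-AtomisticToContinuum-31280 · slot Z `FarAggregatePricing 12 (1/25) (1/2000) (1/(2·10⁷))` · leaf LAB₁′ `ShelteredShellLabelling'`
  (leaf list v14′, critic row 890): part 1 of 2 of the proof of PCR₁ `KissingRelabellingRigidity (1/11)` (part 2 = `…FarKissingRigidity`,
  which imports this file).  decomp-a2c lens-4 «minimal counterexample / extremal reduction», generation 57.
  Imports ONLY `Literature…BarlowTexturedSet`.  0 sorry · 0 axiom · no instance · no notation · no option.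
-/
import Literature.MathematicalPhysics.StatisticalMechanics.BarlowTexturedSet

/-! # The frame lattice of the layer shells, preserved relations, and the linear extension (PROVED)

Tool-box for PCR₁ (rigidity of near-linear relabellings of a kissing configuration, file `…FarKissingRigidity`), at Hales's scale
`layerShell σ τ = 2·barlowShell σ τ` (frame `u₁ = (2,0,0)`, `u₂ = (1,√3,0)`, `w = (u₁+u₂)/3`, `𝗁e₃`, `𝗁² = 8/3`).
* §1 LATTICE GAP.  `Λ = ℤu₁ + ℤw + ℤ𝗁e₃` (`IsFrameInt`) has norm form `‖m u₁ + n w + k 𝗁e₃‖² = (4/3)(3m² + 3mn + n²) + (8/3)k² ≥ 4/3`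
  off the origin (`IsFrameInt.le_inner_self`).
* §2 Every `layerShell σ τ` (`σ, τ = ±1`) lies in `Λ` (`u₂ = 3w − u₁`; `isFrameInt_of_mem_layerShell`) and on the sphere of radius `2`.
* §3 SHORT RELATIONS SURVIVE (`sum_smul_eq_zero_of_relation`).  If `G` maps a set `S` into `V '' layerShell σ' τ'` (`V` a linear isometry)
  and is `η`-close on `S` to a linear map `T`, then an integer relation `Σ cᵢ xᵢ = 0` among points of `S` is preserved, `Σ cᵢ G xᵢ = 0`, as
  soon as `((Σ|cᵢ|) η)² < 4/3`: `T` kills the relation exactly, so `‖Σ cᵢ G xᵢ‖ ≤ (Σ|cᵢ|) η`, while `Σ cᵢ G xᵢ = V z` with `z ∈ Λ`.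
  Specialisations `rel₂` (antipodes), `rel₃` (`x − x' ± z`), `rel₆` (six-term sums) under `27 η² < 1`.
* §4 LINEAR EXTENSION.  Explicit coordinates `coordP/Q/R` in the basis `(u₁, u₂, σw + 𝗁e₃)` of `ℝ³`, the linear map `extensionMap σ A B C`
  with prescribed values on that basis, and the Gram expansion `norm_sq_combo`.
DEGENERATE AUDIT: `T` is any linear map (no invertibility); `V` enters through linearity and `‖Vz‖ = ‖z‖` only; `η < 0` is allowed
(then `S` must be empty of related points — the lemmas stay true).
-/

namespace Summit.AtomisticToContinuum.Crystallization.Theorems.OverbindingBudgetAffineFarSmoothSplit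

open scoped BigOperators RealInnerProductSpace
open Literature.MathematicalPhysics.StatisticalMechanics
open Literature.Geometry.DiscreteGeometry (layerSpacing layerSpacing_sq layerSpacing_pos layerShell hexagonSet holeTriple
  mem_layerShell_iff hexagonSet_subset_layerShell mem_holeTriple_iff mem_holeTriple_one_iff frameW_eq sqrt_three_sq
  inner_frameU_frameU inner_frameV_frameV inner_frameU_frameV inner_frameV_frameU inner_frameU_frameE inner_frameE_frameU
  inner_frameV_frameE inner_frameE_frameV inner_frameE_frameE inner_frameW_frameU inner_frameU_frameW inner_frameW_frameV
  inner_frameV_frameW inner_frameW_frameW inner_frameW_frameE inner_frameE_frameW)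

/-! ## §1  The frame lattice `Λ = ℤu₁ + ℤw + ℤ𝗁e₃` and its gap (PROVED) -/

/-- Membership in `Λ = ℤu₁ + ℤw + ℤ𝗁e₃` (`u₁ = (2,0,0)`, `w = (1, √3/3, 0)`, `𝗁e₃ = (0,0,2√(2/3))`); `Λ` contains every layer shell
`layerShell σ τ`, `σ, τ = ±1` (`isFrameInt_of_mem_layerShell`). [this file] -/
def IsFrameInt (x : EuclideanSpace ℝ (Fin 3)) : Prop :=
  ∃ m n k : ℤ, x = (m : ℝ) • triangularVec₁ (2 : ℝ) + (n : ℝ) • barlowOffset (2 : ℝ) + (k : ℝ) • layerNormal layerSpacing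

/-- Gram form of the lattice frame `(u₁, w, 𝗁e₃)`: `⟪u₁,u₁⟫ = 4`, `⟪u₁,w⟫ = 2`, `⟪w,w⟫ = 4/3`, `⟪𝗁e₃,𝗁e₃⟫ = 8/3`, rest `0`. [folklore] -/
theorem inner_uweCombo (m n k m' n' k' : ℝ) :
    ⟪m • triangularVec₁ (2 : ℝ) + n • barlowOffset (2 : ℝ) + k • layerNormal layerSpacing,
      m' • triangularVec₁ (2 : ℝ) + n' • barlowOffset (2 : ℝ) + k' • layerNormal layerSpacing⟫ =
      4 * m * m' + 2 * m * n' + 2 * n * m' + 4 / 3 * n * n' + 8 / 3 * k * k' := by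
  simp only [inner_add_left, inner_add_right, real_inner_smul_left, real_inner_smul_right, inner_frameU_frameU,
    inner_frameU_frameW, inner_frameW_frameU, inner_frameW_frameW, inner_frameU_frameE, inner_frameE_frameU, inner_frameW_frameE,
    inner_frameE_frameW, inner_frameE_frameE]
  ring

namespace IsFrameInt

/-- `0 ∈ Λ`. [this file] -/
theorem zero : IsFrameInt 0 := ⟨0, 0, 0, by simp⟩

/-- `Λ` is closed under addition. [this file] -/
theorem add {x y : EuclideanSpace ℝ (Fin 3)} (hx : IsFrameInt x) (hy : IsFrameInt y) : IsFrameInt (x + y) := by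
  obtain ⟨m, n, k, rfl⟩ := hx
  obtain ⟨m', n', k', rfl⟩ := hy
  exact ⟨m + m', n + n', k + k', by push_cast; module⟩

/-- `Λ` is closed under integer scalar multiples. [this file] -/
theorem smul_of_eq_intCast {x : EuclideanSpace ℝ (Fin 3)} (hx : IsFrameInt x) {c : ℝ} (hc : ∃ j : ℤ, c = j) :
    IsFrameInt (c • x) := by
  obtain ⟨m, n, k, rfl⟩ := hx
  obtain ⟨j, rfl⟩ := hc
  exact ⟨j * m, j * n, j * k, by push_cast; module⟩

/-- `Λ` is closed under finite sums. [this file] -/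
theorem sum {ι : Type*} (s : Finset ι) {f : ι → EuclideanSpace ℝ (Fin 3)} (h : ∀ i ∈ s, IsFrameInt (f i)) :
    IsFrameInt (∑ i ∈ s, f i) :=
  Finset.sum_induction f IsFrameInt (fun _ _ ha hb => ha.add hb) zero h

/-- **LATTICE GAP (PROVED).** A nonzero vector of `Λ` has squared norm `≥ 4/3`: the form is `(4/3)(3m² + 3mn + n²) + (8/3)k²` and
`4(3m² + 3mn + n²) = 3(2m + n)² + n²` is a positive integer unless `m = n = 0`. [this file] -/
theorem le_inner_self {x : EuclideanSpace ℝ (Fin 3)} (hx : IsFrameInt x) (h0 : x ≠ 0) : 4 / 3 ≤ ⟪x, x⟫ := by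
  obtain ⟨m, n, k, rfl⟩ := hx
  rw [inner_uweCombo]
  by_cases hk : k = 0
  · subst hk
    have hmn : ¬(m = 0 ∧ n = 0) := by
      rintro ⟨rfl, rfl⟩
      exact h0 (by simp)
    have hq : (1 : ℤ) ≤ 3 * m * m + 3 * m * n + n * n := by
      by_contra hlt
      have hq0 : 3 * m * m + 3 * m * n + n * n ≤ 0 := by
        have := Int.lt_iff_add_one_le.mp (not_le.mp hlt)
        linarith
      have hnn : n * n ≤ 0 := by nlinarith [sq_nonneg (2 * m + n)]
      have hn : n = 0 := mul_self_eq_zero.mp (le_antisymm hnn (mul_self_nonneg n))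
      subst hn
      have hmm : m * m ≤ 0 := by linarith
      exact hmn ⟨mul_self_eq_zero.mp (le_antisymm hmm (mul_self_nonneg m)), rfl⟩
    have hqR : (1 : ℝ) ≤ 3 * (m : ℝ) * m + 3 * m * n + (n : ℝ) * n := by exact_mod_cast hq
    push_cast
    linarith
  · have hk1 : (1 : ℝ) ≤ (k : ℝ) * k := by
      have h1 : (1 : ℤ) ≤ |k| := Int.one_le_abs hk
      have h2 : (1 : ℤ) ≤ k * k := by nlinarith [abs_mul_abs_self k, abs_nonneg k]
      exact_mod_cast h2
    nlinarith [sq_nonneg (2 * (m : ℝ) + n), sq_nonneg (n : ℝ)]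

end IsFrameInt

/-! ## §2  Layer shells lie in `Λ` and on the sphere of radius `2` (PROVED) -/

/-- `u₂ = 3w − u₁`. [folklore] -/
theorem frameV_eq_smul_frameW_sub : triangularVec₂ (2 : ℝ) = (3 : ℝ) • barlowOffset (2 : ℝ) - triangularVec₁ (2 : ℝ) := by
  rw [frameW_eq]; module

/-- A sign `±1` is an integer. [folklore] -/
theorem exists_intCast_of_sign {σ : ℝ} (hσ : σ = 1 ∨ σ = -1) : ∃ s : ℤ, σ = s := by
  rcases hσ with rfl | rfl
  exacts [⟨1, by norm_num⟩, ⟨-1, by norm_num⟩]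

/-- **The twelve vectors of a layer shell are lattice vectors**: `±u₁`, `±u₂ = ±(3w − u₁)`, `±(u₁ − u₂)`, `σ{w, w − u₁, w − u₂} + 𝗁e₃`,
`τ{w, w − u₁, w − u₂} − 𝗁e₃`. [HalesDSP2012 §1.3; this file] -/
theorem isFrameInt_of_mem_layerShell {σ τ : ℝ} (hσ : σ = 1 ∨ σ = -1) (hτ : τ = 1 ∨ τ = -1)
    {x : EuclideanSpace ℝ (Fin 3)} (hx : x ∈ layerShell σ τ) : IsFrameInt x := by
  obtain ⟨s, rfl⟩ := exists_intCast_of_sign hσ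
  obtain ⟨t, rfl⟩ := exists_intCast_of_sign hτ
  have hv := frameV_eq_smul_frameW_sub
  rw [mem_layerShell_iff] at hx
  rcases hx with hx | hx | hx
  · simp only [hexagonSet, Set.mem_insert_iff, Set.mem_singleton_iff] at hx
    rcases hx with rfl | rfl | rfl | rfl | rfl | rfl
    · exact ⟨1, 0, 0, by push_cast; module⟩
    · exact ⟨-1, 0, 0, by push_cast; module⟩
    · exact ⟨-1, 3, 0, by rw [hv]; push_cast; module⟩
    · exact ⟨1, -3, 0, by rw [hv]; push_cast; module⟩
    · exact ⟨2, -3, 0, by rw [hv]; push_cast; module⟩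
    · exact ⟨-2, 3, 0, by rw [hv]; push_cast; module⟩
  · obtain ⟨p, hp, hxp⟩ := mem_holeTriple_iff.1 hx
    have hx' : x = (s : ℝ) • p + layerNormal layerSpacing := by rw [← hxp, sub_add_cancel]
    rw [hx']
    rw [mem_holeTriple_one_iff] at hp
    rcases hp with rfl | rfl | rfl
    · exact ⟨0, s, 1, by push_cast; module⟩
    · exact ⟨-s, s, 1, by push_cast; module⟩
    · exact ⟨s, -2 * s, 1, by rw [hv]; push_cast; module⟩
  · obtain ⟨p, hp, hxp⟩ := mem_holeTriple_iff.1 hx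
    have hx' : x = (t : ℝ) • p - layerNormal layerSpacing := by rw [← hxp, add_sub_cancel_right]
    rw [hx']
    rw [mem_holeTriple_one_iff] at hp
    rcases hp with rfl | rfl | rfl
    · exact ⟨0, t, -1, by push_cast; module⟩
    · exact ⟨-t, t, -1, by push_cast; module⟩
    · exact ⟨t, -2 * t, -1, by rw [hv]; push_cast; module⟩

/-- Layer-shell vectors have norm `2` (unit-spacing shell vectors have norm `1`). [HalesDSP2012 §1.3] -/
theorem norm_eq_two_of_mem_layerShell {σ τ : ℝ} (hσ : σ = 1 ∨ σ = -1) (hτ : τ = 1 ∨ τ = -1)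
    {y : EuclideanSpace ℝ (Fin 3)} (hy : y ∈ layerShell σ τ) : ‖y‖ = 2 := by
  have h1 : ‖(2 : ℝ)⁻¹ • y‖ = 1 := norm_eq_one_of_mem_barlowShell hσ hτ ⟨y, hy, rfl⟩
  rw [norm_smul, norm_inv, Real.norm_two] at h1
  linarith

/-! ## §3  Short integer relations among shell vectors are preserved (PROVED) -/

/-- **RELATION LEMMA (PROVED).** If `G` maps `S` into `V '' layerShell σ' τ'` (`V` a linear isometry) and is `η`-close on `S` to a linear
map `T`, then an integer relation `Σ cᵢ xᵢ = 0` among points of `S` with `((Σ|cᵢ|) η)² < 4/3` is preserved: `Σ cᵢ G xᵢ = 0` — it is the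
`V`-image of a vector of `Λ` of norm `≤ (Σ|cᵢ|) η < 2/√3` (§1). [this file] -/
theorem sum_smul_eq_zero_of_relation {ι : Type*} [Fintype ι] {σ' τ' : ℝ} (hσ' : σ' = 1 ∨ σ' = -1) (hτ' : τ' = 1 ∨ τ' = -1)
    {S : Set (EuclideanSpace ℝ (Fin 3))} (V : EuclideanSpace ℝ (Fin 3) →ₗᵢ[ℝ] EuclideanSpace ℝ (Fin 3))
    (T : EuclideanSpace ℝ (Fin 3) →ₗ[ℝ] EuclideanSpace ℝ (Fin 3)) (G : EuclideanSpace ℝ (Fin 3) → EuclideanSpace ℝ (Fin 3))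
    {η : ℝ} (hmaps : Set.MapsTo G S (V '' layerShell σ' τ')) (hclose : ∀ x ∈ S, ‖G x - T x‖ ≤ η)
    {c : ι → ℝ} (hc : ∀ i, ∃ j : ℤ, c i = j) {x : ι → EuclideanSpace ℝ (Fin 3)} (hx : ∀ i, x i ∈ S)
    (hrel : ∑ i, c i • x i = 0) (hη : ((∑ i, |c i|) * η) ^ 2 < 4 / 3) : ∑ i, c i • G (x i) = 0 := by
  -- `T` kills the relation exactly, so the signed sum of the images is small
  have hT : ∑ i, c i • T (x i) = 0 := by
    have h : ∑ i, c i • T (x i) = T (∑ i, c i • x i) := by rw [map_sum]; simp only [map_smul]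
    rw [h, hrel, map_zero]
  have hbound : ‖∑ i, c i • G (x i)‖ ≤ (∑ i, |c i|) * η := by
    have h : ∑ i, c i • G (x i) = ∑ i, c i • (G (x i) - T (x i)) := by
      simp only [smul_sub, Finset.sum_sub_distrib, hT, sub_zero]
    rw [h, Finset.sum_mul]
    refine (norm_sum_le _ _).trans (Finset.sum_le_sum fun i _ => ?_)
    rw [norm_smul, Real.norm_eq_abs]
    exact mul_le_mul_of_nonneg_left (hclose _ (hx i)) (abs_nonneg _)
  -- and it is the `V`-image of a lattice vector
  have hy : ∀ i, ∃ y, y ∈ layerShell σ' τ' ∧ V y = G (x i) := fun i => hmaps (hx i)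
  choose y hyS hVy using hy
  have hVz : V (∑ i, c i • y i) = ∑ i, c i • G (x i) := by
    rw [map_sum]; simp only [LinearIsometry.map_smul, hVy]
  have hz : IsFrameInt (∑ i, c i • y i) :=
    IsFrameInt.sum _ fun i _ => (isFrameInt_of_mem_layerShell hσ' hτ' (hyS i)).smul_of_eq_intCast (hc i)
  by_contra hne
  have hz0 : ∑ i, c i • y i ≠ 0 := fun h0 => hne (by rw [← hVz, h0, map_zero])
  have hgap := hz.le_inner_self hz0
  rw [real_inner_self_eq_norm_sq] at hgap
  have hnz : ‖∑ i, c i • y i‖ ≤ (∑ i, |c i|) * η := by rw [← V.norm_map, hVz]; exact hbound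
  have hsq : ‖∑ i, c i • y i‖ ^ 2 ≤ ((∑ i, |c i|) * η) ^ 2 := pow_le_pow_left₀ (norm_nonneg _) hnz 2
  linarith

section Relations

variable {σ' τ' : ℝ} (hσ' : σ' = 1 ∨ σ' = -1) (hτ' : τ' = 1 ∨ τ' = -1) {S : Set (EuclideanSpace ℝ (Fin 3))}
  (V : EuclideanSpace ℝ (Fin 3) →ₗᵢ[ℝ] EuclideanSpace ℝ (Fin 3)) (T : EuclideanSpace ℝ (Fin 3) →ₗ[ℝ] EuclideanSpace ℝ (Fin 3))
  (G : EuclideanSpace ℝ (Fin 3) → EuclideanSpace ℝ (Fin 3)) {η : ℝ} (hmaps : Set.MapsTo G S (V '' layerShell σ' τ'))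
  (hclose : ∀ x ∈ S, ‖G x - T x‖ ≤ η)
include hσ' hτ' hmaps hclose

/-- Antipodal relations `x + x' = 0` are preserved (`27η² < 1`). [this file] -/
theorem rel₂ {x x' : EuclideanSpace ℝ (Fin 3)} (hx : x ∈ S) (hx' : x' ∈ S)
    (hrel : (1 : ℝ) • x + (1 : ℝ) • x' = 0) (hη : 27 * η ^ 2 < 1) : (1 : ℝ) • G x + (1 : ℝ) • G x' = 0 := by
  have h := sum_smul_eq_zero_of_relation hσ' hτ' V T G hmaps hclose (c := ![(1 : ℝ), 1]) (x := ![x, x'])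
    (fun i => by fin_cases i <;> exact ⟨1, by norm_num⟩) (fun i => by fin_cases i <;> assumption)
    (by simpa [Fin.sum_univ_two] using hrel) (by norm_num [Fin.sum_univ_two]; nlinarith [hη])
  simpa [Fin.sum_univ_two] using h

/-- Three-term relations `x − x' + c z = 0`, `c = ±1`, are preserved (`27η² < 1`). [this file] -/
theorem rel₃ {c : ℝ} (hc : c = 1 ∨ c = -1) {x x' z : EuclideanSpace ℝ (Fin 3)} (hx : x ∈ S) (hx' : x' ∈ S) (hz : z ∈ S)
    (hrel : (1 : ℝ) • x + (-1 : ℝ) • x' + c • z = 0) (hη : 27 * η ^ 2 < 1) :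
    (1 : ℝ) • G x + (-1 : ℝ) • G x' + c • G z = 0 := by
  have habs : |c| = 1 := by rcases hc with rfl | rfl <;> norm_num
  have h := sum_smul_eq_zero_of_relation hσ' hτ' V T G hmaps hclose (c := ![(1 : ℝ), -1, c]) (x := ![x, x', z])
    (fun i => by fin_cases i; exacts [⟨1, by norm_num⟩, ⟨-1, by norm_num⟩, exists_intCast_of_sign hc])
    (fun i => by fin_cases i <;> assumption)
    (by simpa [Fin.sum_univ_three] using hrel)
    (by simp [Fin.sum_univ_three, Matrix.cons_val_two, Matrix.vecHead, Matrix.vecTail, habs]; nlinarith [hη])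
  simpa [Fin.sum_univ_three] using h

/-- Six-term relations `x₁ + ⋯ + x₆ = 0` are preserved (`27η² < 1`, i.e. `(6η)² < 4/3`). [this file] -/
theorem rel₆ {x₁ x₂ x₃ x₄ x₅ x₆ : EuclideanSpace ℝ (Fin 3)} (h₁ : x₁ ∈ S) (h₂ : x₂ ∈ S) (h₃ : x₃ ∈ S) (h₄ : x₄ ∈ S)
    (h₅ : x₅ ∈ S) (h₆ : x₆ ∈ S) (hrel : x₁ + x₂ + x₃ + x₄ + x₅ + x₆ = 0) (hη : 27 * η ^ 2 < 1) :
    G x₁ + G x₂ + G x₃ + G x₄ + G x₅ + G x₆ = 0 := by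
  have h := sum_smul_eq_zero_of_relation hσ' hτ' V T G hmaps hclose (c := fun _ : Fin 6 => (1 : ℝ))
    (x := ![x₁, x₂, x₃, x₄, x₅, x₆]) (fun _ => ⟨1, by norm_num⟩) (fun i => by fin_cases i <;> assumption)
    (by simpa [Fin.sum_univ_six] using hrel) (by norm_num; nlinarith [hη])
  simpa [Fin.sum_univ_six] using h

end Relations

/-! ## §4  The linear extension from the basis `(u₁, u₂, σw + 𝗁e₃)` and its Gram matrix (PROVED) -/

/-- First coordinate of `z ∈ ℝ³` in the basis `(u₁, u₂, σw + 𝗁e₃)` (`coord_decomp`). [this file] -/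
noncomputable def coordP (σ : ℝ) (z : EuclideanSpace ℝ (Fin 3)) : ℝ := (z 0 - z 1 / Real.sqrt 3) / 2 - σ / 3 * (z 2 / layerSpacing)
/-- Second coordinate of `z ∈ ℝ³` in the basis `(u₁, u₂, σw + 𝗁e₃)` (`coord_decomp`). [this file] -/
noncomputable def coordQ (σ : ℝ) (z : EuclideanSpace ℝ (Fin 3)) : ℝ := z 1 / Real.sqrt 3 - σ / 3 * (z 2 / layerSpacing)
/-- Third coordinate of `z ∈ ℝ³` in the basis `(u₁, u₂, σw + 𝗁e₃)` (`coord_decomp`). [this file] -/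
noncomputable def coordR (z : EuclideanSpace ℝ (Fin 3)) : ℝ := z 2 / layerSpacing

/-- `z = P u₁ + Q u₂ + R (σw + 𝗁e₃)`. [this file] -/
theorem coord_decomp (σ : ℝ) (z : EuclideanSpace ℝ (Fin 3)) :
    z = coordP σ z • triangularVec₁ (2 : ℝ) + coordQ σ z • triangularVec₂ (2 : ℝ) +
      coordR z • (σ • barlowOffset (2 : ℝ) + layerNormal layerSpacing) := by
  have h3 : Real.sqrt 3 ≠ 0 := by positivity
  have hh : layerSpacing ≠ 0 := layerSpacing_pos.ne'
  ext i
  fin_cases i <;> simp [coordP, coordQ, coordR] <;> field_simp <;> ring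

/-- The coordinates of a combination of the basis vectors are its coefficients. [this file] -/
theorem coord_combo (σ a b c : ℝ) :
    coordP σ (a • triangularVec₁ (2 : ℝ) + b • triangularVec₂ (2 : ℝ) + c • (σ • barlowOffset (2 : ℝ) + layerNormal layerSpacing)) = a ∧
    coordQ σ (a • triangularVec₁ (2 : ℝ) + b • triangularVec₂ (2 : ℝ) + c • (σ • barlowOffset (2 : ℝ) + layerNormal layerSpacing)) = b ∧
    coordR (a • triangularVec₁ (2 : ℝ) + b • triangularVec₂ (2 : ℝ) + c • (σ • barlowOffset (2 : ℝ) + layerNormal layerSpacing)) = c := by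
  have h3 : Real.sqrt 3 ≠ 0 := by positivity
  have hh : layerSpacing ≠ 0 := layerSpacing_pos.ne'
  refine ⟨?_, ?_, ?_⟩ <;> simp [coordP, coordQ, coordR] <;> field_simp <;> ring

/-- The linear map with prescribed values `A, B, C` on the basis `(u₁, u₂, σw + 𝗁e₃)`. [this file] -/
noncomputable def extensionMap (σ : ℝ) (A B C : EuclideanSpace ℝ (Fin 3)) : EuclideanSpace ℝ (Fin 3) →ₗ[ℝ] EuclideanSpace ℝ (Fin 3) where
  toFun z := coordP σ z • A + coordQ σ z • B + coordR z • C
  map_add' z z' := by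
    simp only [coordP, coordQ, coordR, PiLp.add_apply]
    module
  map_smul' r z := by
    simp only [coordP, coordQ, coordR, PiLp.smul_apply, smul_eq_mul, RingHom.id_apply]
    module

/-- Unfolding lemma for `extensionMap`. [this file] -/
theorem extensionMap_apply (σ : ℝ) (A B C z : EuclideanSpace ℝ (Fin 3)) :
    extensionMap σ A B C z = coordP σ z • A + coordQ σ z • B + coordR z • C := rfl

/-- The extension takes the prescribed values on combinations of the basis. [this file] -/
theorem extensionMap_combo (σ : ℝ) (A B C : EuclideanSpace ℝ (Fin 3)) (a b c : ℝ) :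
    extensionMap σ A B C (a • triangularVec₁ (2 : ℝ) + b • triangularVec₂ (2 : ℝ) +
      c • (σ • barlowOffset (2 : ℝ) + layerNormal layerSpacing)) = a • A + b • B + c • C := by
  obtain ⟨hP, hQ, hR⟩ := coord_combo σ a b c
  rw [extensionMap_apply, hP, hQ, hR]

/-- `‖aA + bB + cC‖²` through the Gram matrix. [folklore] -/
theorem norm_sq_combo (A B C : EuclideanSpace ℝ (Fin 3)) (a b c : ℝ) :
    ‖a • A + b • B + c • C‖ ^ 2 =
      a ^ 2 * ⟪A, A⟫ + b ^ 2 * ⟪B, B⟫ + c ^ 2 * ⟪C, C⟫ + 2 * a * b * ⟪A, B⟫ + 2 * a * c * ⟪A, C⟫ + 2 * b * c * ⟪B, C⟫ := by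
  rw [← real_inner_self_eq_norm_sq]
  simp only [inner_add_left, inner_add_right, real_inner_smul_left, real_inner_smul_right]
  rw [real_inner_comm A B, real_inner_comm A C, real_inner_comm B C]
  ring

end Summit.AtomisticToContinuum.Crystallization.Theorems.OverbindingBudgetAffineFarSmoothSplit
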